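import Summits.BirchSwinnertonDyer.BirchSwinnertonDyer.Theorems.ManinLocalTwoThreeHalvingCoverUDC
import Literature.NumberTheory.EllipticCurves.ManinConstantGamma1Gamma0Comparison
import Literature.NumberTheory.Automorphic.WohlfahrtTheorem
import HarnessLib

/-!
# THE DIVISION COVER ON `Γ₁(N)`: Unbounded Denominators on the `m`-division cover of the OPTIMAL `X₁(N)`-parametrisation —
# `m ∤ c₁` for every `m ≥ 2` modulo ONE analytic witness law per `m`; hence `|c₁| = 1` (Stevens' `c_φ = ±1`) conditionally on CDT

Summit `BirchSwinnertonDyer`, route `ManinLocalTwoThree` (cell bsd-f2-manin), cruxes C2 `ManinOddAtFour` (stmt-BirchSwinnertonDyer-22967) and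
C3 (stmt-…-22968); lead p1 gen 19 (LEAD-MEMO v39).  Companion of `ManinLocalTwoThreeHalvingCoverUDC.lean` (lead p1 gen 18), which runs the same
idea on `X₀(N)`.

THE IDEA.  Let `D₁` be an OPTIMAL `X₁(N)`-datum of a globally minimal `W` (`Gamma1ParametrizationData`, `IsOptimal`: `Λ_W = c₁·Λ₁(f)`) and `m ≥ 2`
with `m ∣ c₁`, `c' := c₁/m`.  The DIVISION POINT `Q(τ) := c'·E_f(τ) mod Λ_W` (`mQ = φ₁(τ)`) moves under `γ ∈ Γ₁(N)` by the `m`-torsion point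
`c'·{∞,γ∞}_f mod Λ_W`, so every function of `Q` is modular for EXACTLY the **division cover group** `Γ₁^{(m)} := {γ ∈ Γ₁(N) : c₁·{∞,γ∞}_f ∈ mΛ_W}`
— finite index in `Γ₁(N)`, containing EVERY trace-`2` element of `Γ₁(N)` (zero period) (§2).  THE POINT (§1): on `Γ₁(N)` there is NO index
escape — a subgroup `Γ ≤ SL₂(ℤ)` containing every trace-`2` element of `Γ₁(N)` and some `Γ(M)` contains all conjugates `g Tᴺ g⁻¹` (trace-`2`
elements of `Γ(N) ≤ Γ₁(N)`), hence `Γ(N)` by WOHLFAHRT'S THEOREM (tree, `Wohlfahrt.Gamma_le_of_isCongruenceSubgroup_of_forall_conj_T_pow_mem`), and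
`T`, hence `Γ₁(N) = Γ(N)·⟨T⟩`.  So if `Γ₁^{(m)}` is congruence then `c₁Λ₁(f) ⊆ mΛ_W = m·c₁Λ₁(f)` — ABSURD (`ω₁/m ∉ Λ_W`, §3).  The parameter
`t(Q(τ)) = −x/y(Q)` has `q`-expansion `exp_W(c'·Σ aₙqⁿ/n) ∈ ℤ⟦q⟧` (Honda at the INTEGER `c'`), so a pole-cleared `F = t(Q)·B_d·Δ^k` is a holomorphic
weight-`k` form for `Γ₁^{(m)}` with algebraic-integer coefficients — the **`m`-division witness on `Γ₁`** (the one analytic input, shaped exactly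
like the halving witness of the C2 line of record with `D₁` for `D`); Unbounded Denominators (CDT) makes `Γ₁^{(m)}` congruence (§4).  Hence
**`m ∤ c₁` modulo CDT ∧ (`m`-division witness on `Γ₁`)** for every optimal `X₁(N)`-parametrisation, every `m ≥ 2`, every level, and
**`|c₁| = 1` modulo CDT ∧ (the `p`-division witnesses)** (§5) — Stevens' conjecture `c_φ = ±1` [Stevens 1989] in conditional form.  For the cell:
with the tree's `|c₀| ∈ {|c₁|, 2|c₁|}` at `4 ∣ N` (`natAbs_maninConstant₀_eq_or_eq_two_mul_of_four_dvd_level`) this pins `c₀ ∈ {±1, ±2}`, with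
`c₀ = ±2` iff the index-`4` world (so E-an-152b is exactly C2, modulo CDT and the witnesses).

* §1 `gamma1_le_of_Gamma_le_of_forall_trace_two_mem` — Wohlfahrt inside `Γ₁(n)` (pure group theory, PROVED from the tree's Wohlfahrt theorem).
* §2 `exists_divisionCoverSubgroupGamma1` — `Γ₁^{(m)}` inside `Γ₁(N)`: finite index (`m²` cosets), trace-`±2` elements.
* §3 `not_forall_gamma1_division_of_isOptimal` — `Γ₁(N) ≤ Γ₁^{(m)}` contradicts optimality (`m ≥ 2`).
* §4 `forall_gamma1_division_of_divisionWitness_of_UDW` (UDC glue) and `not_dvd_maninConstant₁_of_CDT_of_divisionWitnessLaw₁`.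
* §5 `abs_maninConstant₁_eq_one_of_CDT_of_divisionWitnessLaws₁` (`|c₁| = 1`; the `m = 2` instance «`c₁` odd» is in `…DivisionCoverUDC.lean`).

HONEST FRAMING: CONDITIONAL on the printed CDT fact (`CalegariDimitrovTang2025_unboundedDenominators_algInt`) and on the OPEN analytic `m`-division
witness laws on `Γ₁` (bookkeeping with a complete paper proof: Honda at `c₁/m`, pole-killing `B_d` at the algebraic points `φ₁⁻¹(m·R)`, `R ∈ {y = 0}`,
stabiliser exactness `t(P + T) ≡ t(P) ⟹ T = O`); Stevens' conjecture, Manin's conjecture, C2/C3 and BSD are NOT proved by this file.  No definitions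
(the subgroup is an existential witness), no sorry.
[cite: Wohlfahrt1964, Thm. 2] [cite: CalegariDimitrovTang2025, Thm. 1.0.1, §4.1 and Lemma 30] [cite: Stevens1989, §2 (the `X₁(N)`-optimal curve;
Conj. `c = ±1`)] [cite: KurthLong2008, Prop. 18 (the `Γ₀` analogue)] [cite: Manin1972, Prop. 1.4 / Thm. 1.6] [cite: Honda1970, Thm. 9]
-/

set_option autoImplicit false
-- lint-debt: the directory name repeats the summit name (sibling precedent `ManinLocalTwoThreeHalvingCoverUDC.lean`)
set_option linter.dupNamespace false

noncomputable section

open scoped MatrixGroups ModularForm Manifold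
open CongruenceSubgroup ModularGroup Matrix.SpecialLinearGroup
open WeierstrassCurve Literature.NumberTheory.EllipticCurves Literature.NumberTheory.EllipticCurves.ModularForms
open Literature.NumberTheory.Automorphic
open Summit.BirchSwinnertonDyer.Rank1Residual.ManinAdditive.UDCKummerLineK

namespace Summit.BirchSwinnertonDyer.BirchSwinnertonDyer.Theorems.ManinLocalTwoThree.DivisionGamma1

/-! ## §1 Wohlfahrt inside `Γ₁(n)`: no index escape -/

/-- Entries of `γ * T ^ k`: right multiplication by `T ^ k = [1, k; 0, 1]` adds `k` times the first column to the second. [folklore] -/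
theorem mul_T_zpow_apply (γ : SL(2, ℤ)) (k : ℤ) :
    (γ * T ^ k) 0 0 = γ 0 0 ∧ (γ * T ^ k) 0 1 = γ 0 0 * k + γ 0 1 ∧
      (γ * T ^ k) 1 0 = γ 1 0 ∧ (γ * T ^ k) 1 1 = γ 1 0 * k + γ 1 1 := by
  have h : (↑(γ * T ^ k) : Matrix (Fin 2) (Fin 2) ℤ) = (↑γ : Matrix (Fin 2) (Fin 2) ℤ) * !![1, k; 0, 1] := by
    rw [coe_mul, coe_T_zpow]
  refine ⟨?_, ?_, ?_, ?_⟩ <;>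
  · rw [h]; simp [Matrix.mul_apply, Fin.sum_univ_two]

/-- The trace of a conjugate `g * T ^ N * g⁻¹` is `2`. [folklore] -/
theorem trace_conj_T_pow (g : SL(2, ℤ)) (N : ℕ) :
    (g * T ^ N * g⁻¹) 0 0 + (g * T ^ N * g⁻¹) 1 1 = 2 := by
  have htr : ∀ A : SL(2, ℤ), A 0 0 + A 1 1 = (↑A : Matrix (Fin 2) (Fin 2) ℤ).trace := fun A ↦ by
    simp [Matrix.trace, Fin.sum_univ_two]
  have hT : ((T ^ N : SL(2, ℤ)) : Matrix (Fin 2) (Fin 2) ℤ) = !![1, (N : ℤ); 0, 1] := by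
    rw [← zpow_natCast, coe_T_zpow]
  rw [htr, coe_mul, coe_mul, Matrix.trace_mul_cycle, ← coe_mul, inv_mul_cancel,
    Matrix.SpecialLinearGroup.coe_one, Matrix.one_mul, hT]
  simp [Matrix.trace, Fin.sum_univ_two]

/-- **Wohlfahrt inside `Γ₁(n)` — a congruence subgroup containing every parabolic of `Γ₁(n)` contains `Γ₁(n)`.**  If `Γ ≤ SL₂(ℤ)` contains
every element of `Γ₁(n)` of trace `2` and some principal congruence subgroup `Γ(M)`, `M > 0`, then `Γ₁(n) ≤ Γ`: every conjugate `g Tⁿ g⁻¹` is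
a trace-`2` element of `Γ(n) ≤ Γ₁(n)`, so Wohlfahrt's theorem gives `Γ(n) ≤ Γ`, and `T ∈ Γ` gives `Γ₁(n) = Γ(n)·⟨T⟩ ≤ Γ`.  (Contrast with
`Γ₀(n)`: there the same argument only yields `Γ₁(n) ≤ Γ` — Kurth–Long Prop. 18, tree `KurthLong2008_prop18_typeII_noncongruence` — which leaves
the character covers `Γ₁(n) ≤ Γ ≤ Γ₀(n)`; inside `Γ₁(n)` nothing is left.) [cite: Wohlfahrt1964, Thm. 2] [cite: CalegariDimitrovTang2025, §4.1 and Lemma 30] -/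
theorem gamma1_le_of_Gamma_le_of_forall_trace_two_mem (n : ℕ) (Γ : Subgroup SL(2, ℤ))
    (hII : ∀ γ ∈ Gamma1 n, γ 0 0 + γ 1 1 = 2 → γ ∈ Γ) {M : ℕ} (hM : 0 < M)
    (hΓM : CongruenceSubgroup.Gamma M ≤ Γ) : Gamma1 n ≤ Γ := by
  have hcong : IsCongruenceSubgroup Γ := ⟨M, hM.ne', hΓM⟩
  -- every conjugate of `T ^ n` lies in `Γ(n) ≤ Γ₁(n)` and has trace `2`, hence lies in `Γ`
  have hconj : ∀ g : SL(2, ℤ), g * T ^ n * g⁻¹ ∈ Γ := by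
    intro g
    have hTn : T ^ n ∈ Gamma n := by
      have := ModularGroup_T_pow_mem_Gamma (n : ℤ) (n : ℤ) dvd_rfl
      rwa [Int.natAbs_natCast, zpow_natCast] at this
    have hmem : g * T ^ n * g⁻¹ ∈ Gamma n := (Gamma_normal n).conj_mem _ hTn g
    have h1 : g * T ^ n * g⁻¹ ∈ Gamma1 n := by
      rw [Gamma1_mem]
      obtain ⟨h00, -, h10, h11⟩ := Gamma_mem.mp hmem
      exact ⟨h00, h11, h10⟩
    exact hII _ h1 (trace_conj_T_pow g n)
  -- Wohlfahrt: `Γ(n) ≤ Γ`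
  have hΓn : Gamma n ≤ Γ := Wohlfahrt.Gamma_le_of_isCongruenceSubgroup_of_forall_conj_T_pow_mem hcong hconj
  -- `T ∈ Γ` (trace `2`, `T ∈ Γ₁(n)`)
  have hT : T ∈ Γ := by
    refine hII T (by rw [Gamma1_mem]; simp [ModularGroup.T]) ?_
    simp [ModularGroup.T]
  -- `Γ₁(n) = Γ(n) · ⟨T⟩ ≤ Γ`
  intro γ hγ
  obtain ⟨h00, h11, h10⟩ := (Gamma1_mem n γ).mp hγ
  set b : ℤ := γ 0 1 with hb
  have hprod : γ * T ^ (-b) ∈ Gamma n := by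
    obtain ⟨e00, e01, e10, e11⟩ := mul_T_zpow_apply γ (-b)
    rw [Gamma_mem, e00, e01, e10, e11]
    refine ⟨h00, ?_, h10, ?_⟩
    · push_cast; rw [h00]; ring
    · push_cast; rw [h10, h11]; ring
  have : γ = γ * T ^ (-b) * T ^ b := by rw [mul_assoc, ← zpow_add, neg_add_cancel, zpow_zero, mul_one]
  rw [this]
  exact mul_mem (hΓn hprod) (Subgroup.zpow_mem Γ hT b)

/-! ## §2 The division cover group `Γ₁^{(m)} = {γ ∈ Γ₁(N) : c₁·{∞,γ∞}_f ∈ mΛ_W}` -/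

/-- `m²` classes: every `x ∈ Λ_W` is `≡ iω₁ + jω₂ (mod mΛ_W)` with `i, j < m`. [folklore] -/
theorem exists_sq_classes (L : PeriodPair) {m : ℕ} (hm : 0 < m) :
    ∀ x ∈ L.lattice, ∃ i j : ℕ, i < m ∧ j < m ∧ ∃ ν ∈ L.lattice, x - (i : ℂ) * L.ω₁ - (j : ℂ) * L.ω₂ = (m : ℂ) * ν := by
  intro x hx
  obtain ⟨a, b, rfl⟩ := PeriodPair.mem_lattice.mp hx
  have hm0 : (0 : ℤ) < (m : ℤ) := by exact_mod_cast hm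
  have ha0 : 0 ≤ a % (m : ℤ) := Int.emod_nonneg _ hm0.ne'
  have hb0 : 0 ≤ b % (m : ℤ) := Int.emod_nonneg _ hm0.ne'
  have ham : a % (m : ℤ) < m := Int.emod_lt_of_pos _ hm0
  have hbm : b % (m : ℤ) < m := Int.emod_lt_of_pos _ hm0
  refine ⟨(a % (m : ℤ)).toNat, (b % (m : ℤ)).toNat, ?_, ?_, ?_⟩
  · have : (((a % (m : ℤ)).toNat : ℕ) : ℤ) < (m : ℤ) := by rw [Int.toNat_of_nonneg ha0]; exact ham
    exact_mod_cast this
  · have : (((b % (m : ℤ)).toNat : ℕ) : ℤ) < (m : ℤ) := by rw [Int.toNat_of_nonneg hb0]; exact hbm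
    exact_mod_cast this
  refine ⟨((a / (m : ℤ) : ℤ) : ℂ) * L.ω₁ + ((b / (m : ℤ) : ℤ) : ℂ) * L.ω₂, PeriodPair.mem_lattice.mpr ⟨_, _, rfl⟩, ?_⟩
  have hi : (((a % (m : ℤ)).toNat : ℕ) : ℂ) = ((a % (m : ℤ) : ℤ) : ℂ) := by
    rw [← Int.cast_natCast, Int.toNat_of_nonneg ha0]
  have hj : (((b % (m : ℤ)).toNat : ℕ) : ℂ) = ((b % (m : ℤ) : ℤ) : ℂ) := by
    rw [← Int.cast_natCast, Int.toNat_of_nonneg hb0]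
  have ea' : a = (m : ℤ) * (a / (m : ℤ)) + a % (m : ℤ) := (Int.mul_ediv_add_emod a m).symm
  have eb' : b = (m : ℤ) * (b / (m : ℤ)) + b % (m : ℤ) := (Int.mul_ediv_add_emod b m).symm
  have ea : (a : ℂ) = (m : ℂ) * ((a / (m : ℤ) : ℤ) : ℂ) + ((a % (m : ℤ) : ℤ) : ℂ) := by exact_mod_cast ea'
  have eb : (b : ℂ) = (m : ℂ) * ((b / (m : ℤ) : ℤ) : ℂ) + ((b % (m : ℤ) : ℤ) : ℂ) := by exact_mod_cast eb'
  rw [hi, hj, ea, eb]; ring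

variable {W : WeierstrassCurve ℚ} {N : ℕ} [NeZero N]

/-- **The division cover group on `Γ₁(N)`.**  For an `X₁(N)`-datum `D` and `m > 0`: `Γ₁^{(m)} = {γ ∈ Γ₁(N) : c·{∞,γ∞}_f ∈ mΛ_W}` is a
subgroup of `SL₂(ℤ)` inside `Γ₁(N)`, of finite index (at most `m²` cosets over `Γ₁(N)`; Manin's homomorphism `cuspSymbol_mul_holds`), containing
every element of `Γ₁(N)` of trace `±2` (zero discriminant ⟹ zero period).  It is the monodromy group of the `m`-division cover
`{(x, Q) : mQ = φ₁(x)}` of `X₁(N)`. [cite: Manin1972, Prop. 1.4 / Thm. 1.6] [cite: KurthLong2008, Def. 16 (type II; shape)] -/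
theorem exists_divisionCoverSubgroupGamma1 (D : Gamma1ParametrizationData W N) {m : ℕ} (hm : 0 < m) :
    ∃ Γ : Subgroup SL(2, ℤ),
      (∀ γ : Gamma1 N, (γ : SL(2, ℤ)) ∈ Γ ↔
        ∃ ν ∈ D.L.lattice, (D.c : ℂ) * cuspSymbol D.f ⟨(γ : SL(2, ℤ)), Gamma1_in_Gamma0 N γ.2⟩ = (m : ℂ) * ν) ∧
      Γ ≤ Gamma1 N ∧ Γ.FiniteIndex ∧
      (∀ γ (hγ : γ ∈ Gamma1 N), (γ 0 0 + γ 1 1 = 2 ∨ γ 0 0 + γ 1 1 = -2) → γ ∈ Γ) := by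
  -- the period character on `Γ₁(N)`, read through `Γ₀(N)`
  let per : Gamma1 N → ℂ := fun γ ↦ cuspSymbol D.f ⟨(γ : SL(2, ℤ)), Gamma1_in_Gamma0 N γ.2⟩
  have per_mul : ∀ γ₁ γ₂ : Gamma1 N, per (γ₁ * γ₂) = per γ₁ + per γ₂ := by
    intro γ₁ γ₂
    show cuspSymbol D.f ⟨((γ₁ * γ₂ : Gamma1 N) : SL(2, ℤ)), _⟩ = cuspSymbol D.f ⟨(γ₁ : SL(2, ℤ)), _⟩ + cuspSymbol D.f ⟨(γ₂ : SL(2, ℤ)), _⟩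
    have : (⟨((γ₁ * γ₂ : Gamma1 N) : SL(2, ℤ)), Gamma1_in_Gamma0 N (γ₁ * γ₂).2⟩ : Gamma0 N) =
        ⟨(γ₁ : SL(2, ℤ)), Gamma1_in_Gamma0 N γ₁.2⟩ * ⟨(γ₂ : SL(2, ℤ)), Gamma1_in_Gamma0 N γ₂.2⟩ := rfl
    rw [this, cuspSymbol_mul_holds]
  have per_one : per 1 = 0 := by
    show cuspSymbol D.f ⟨((1 : Gamma1 N) : SL(2, ℤ)), _⟩ = 0
    have : (⟨((1 : Gamma1 N) : SL(2, ℤ)), Gamma1_in_Gamma0 N (1 : Gamma1 N).2⟩ : Gamma0 N) = 1 := rfl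
    rw [this, cuspSymbol_one]
  have per_inv : ∀ γ : Gamma1 N, per γ⁻¹ = -per γ := by
    intro γ
    have h := per_mul γ⁻¹ γ
    rw [inv_mul_cancel, per_one] at h
    linear_combination -h
  let Γ : Subgroup SL(2, ℤ) :=
    { carrier := {g | ∃ hg : g ∈ Gamma1 N, ∃ ν ∈ D.L.lattice, (D.c : ℂ) * per ⟨g, hg⟩ = (m : ℂ) * ν}
      one_mem' := ⟨(Gamma1 N).one_mem, 0, zero_mem _, by
        have : (⟨1, (Gamma1 N).one_mem⟩ : Gamma1 N) = 1 := rfl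
        rw [this, per_one]; simp⟩
      mul_mem' := by
        rintro g₁ g₂ ⟨hg₁, ν₁, hν₁, e₁⟩ ⟨hg₂, ν₂, hν₂, e₂⟩
        refine ⟨(Gamma1 N).mul_mem hg₁ hg₂, ν₁ + ν₂, add_mem hν₁ hν₂, ?_⟩
        have : (⟨g₁ * g₂, (Gamma1 N).mul_mem hg₁ hg₂⟩ : Gamma1 N) = ⟨g₁, hg₁⟩ * ⟨g₂, hg₂⟩ := rfl
        rw [this, per_mul, mul_add, e₁, e₂]; ring
      inv_mem' := by
        rintro g ⟨hg, ν, hν, e⟩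
        refine ⟨(Gamma1 N).inv_mem hg, -ν, neg_mem hν, ?_⟩
        have : (⟨g⁻¹, (Gamma1 N).inv_mem hg⟩ : Gamma1 N) = ⟨g, hg⟩⁻¹ := rfl
        rw [this, per_inv, mul_neg, e]; ring }
  have hmem : ∀ γ : Gamma1 N, (γ : SL(2, ℤ)) ∈ Γ ↔
      ∃ ν ∈ D.L.lattice, (D.c : ℂ) * cuspSymbol D.f ⟨(γ : SL(2, ℤ)), Gamma1_in_Gamma0 N γ.2⟩ = (m : ℂ) * ν := by
    intro γ
    constructor
    · rintro ⟨_, ν, hν, e⟩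
      exact ⟨ν, hν, e⟩
    · rintro ⟨ν, hν, e⟩
      exact ⟨γ.2, ν, hν, e⟩
  refine ⟨Γ, hmem, fun g hg ↦ hg.1, ?_, ?_⟩
  · -- FINITE INDEX: at most `m²` cosets over `Γ₁(N)`
    classical
    have hcl : ∀ γ : Gamma1 N, ∃ i j : ℕ, i < m ∧ j < m ∧ ∃ ν ∈ D.L.lattice,
        (D.c : ℂ) * per γ - (i : ℂ) * D.L.ω₁ - (j : ℂ) * D.L.ω₂ = (m : ℂ) * ν := fun γ ↦
      exists_sq_classes D.L hm _ (D.smul_periodLatticeGamma1_le _ (cuspSymbol_mem_periodLatticeGamma1 D.f γ))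
    have hrep : ∀ p : Fin m × Fin m, ∃ g : Gamma1 N, (∃ γ : Gamma1 N, ∃ ν ∈ D.L.lattice,
        (D.c : ℂ) * per γ - ((p.1 : ℕ) : ℂ) * D.L.ω₁ - ((p.2 : ℕ) : ℂ) * D.L.ω₂ = (m : ℂ) * ν) →
        ∃ ν ∈ D.L.lattice, (D.c : ℂ) * per g - ((p.1 : ℕ) : ℂ) * D.L.ω₁ - ((p.2 : ℕ) : ℂ) * D.L.ω₂ = (m : ℂ) * ν := by
      intro p
      by_cases h : ∃ γ : Gamma1 N, ∃ ν ∈ D.L.lattice,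
          (D.c : ℂ) * per γ - ((p.1 : ℕ) : ℂ) * D.L.ω₁ - ((p.2 : ℕ) : ℂ) * D.L.ω₂ = (m : ℂ) * ν
      · obtain ⟨γ, hγ⟩ := h; exact ⟨γ, fun _ ↦ hγ⟩
      · exact ⟨1, fun h' ↦ absurd h' h⟩
    choose rep hrep using hrep
    have hcoset : ∀ γ : Gamma1 N, ∃ p : Fin m × Fin m, ((rep p : SL(2, ℤ)))⁻¹ * (γ : SL(2, ℤ)) ∈ Γ := by
      intro γ
      obtain ⟨i, j, hi, hj, ν, hν, e⟩ := hcl γ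
      set p : Fin m × Fin m := (⟨i, hi⟩, ⟨j, hj⟩) with hp
      obtain ⟨ν', hν', e'⟩ := hrep p ⟨γ, ν, hν, by rw [hp]; exact e⟩
      refine ⟨p, (hmem ((rep p)⁻¹ * γ)).mpr ⟨ν - ν', sub_mem hν hν', ?_⟩⟩
      show (D.c : ℂ) * per ((rep p)⁻¹ * γ) = (m : ℂ) * (ν - ν')
      rw [per_mul, per_inv]
      have e'' : (D.c : ℂ) * per (rep p) - (i : ℂ) * D.L.ω₁ - (j : ℂ) * D.L.ω₂ = (m : ℂ) * ν' := by rw [hp] at e'; exact e'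
      linear_combination e - e''
    haveI : Finite (SL(2, ℤ) ⧸ Γ) := by
      refine Finite.of_surjective
        (fun q : (SL(2, ℤ) ⧸ Gamma1 N) × (Fin m × Fin m) ↦
          (QuotientGroup.mk (q.1.out * (rep q.2 : SL(2, ℤ))) : SL(2, ℤ) ⧸ Γ)) ?_
      intro q
      induction q using QuotientGroup.induction_on with
      | H g =>
        obtain ⟨h, hh⟩ := QuotientGroup.mk_out_eq_mul (Gamma1 N) g
        obtain ⟨p, hδ⟩ := hcoset h⁻¹
        refine ⟨(QuotientGroup.mk g, p), ?_⟩
        show (QuotientGroup.mk ((QuotientGroup.mk g : SL(2, ℤ) ⧸ Gamma1 N).out * (rep p : SL(2, ℤ))) : SL(2, ℤ) ⧸ Γ) =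
          QuotientGroup.mk g
        rw [QuotientGroup.eq, hh]
        have e : ((g : SL(2, ℤ)) * (h : SL(2, ℤ)) * (rep p : SL(2, ℤ)))⁻¹ * g =
            ((rep p : SL(2, ℤ)))⁻¹ * ((h⁻¹ : Gamma1 N) : SL(2, ℤ)) := by
          rw [Subgroup.coe_inv]; group
        rw [e]; exact hδ
    exact Subgroup.finiteIndex_of_finite_quotient
  · -- trace `±2` ⟹ zero discriminant ⟹ zero period
    intro γ hγ htr
    refine ⟨hγ, 0, zero_mem _, ?_⟩
    have hγ0 : γ ∈ Gamma0 N := Gamma1_in_Gamma0 N hγ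
    have hdet : ((γ : Matrix (Fin 2) (Fin 2) ℤ)).det = 1 := γ.2
    have hdisc : ((((⟨γ, hγ0⟩ : Gamma0 N) : SL(2, ℤ)) : Matrix (Fin 2) (Fin 2) ℤ)).discr = 0 := by
      show ((γ : Matrix (Fin 2) (Fin 2) ℤ)).discr = 0
      rw [Matrix.discr_fin_two, Matrix.trace_fin_two, hdet]
      rcases htr with h | h <;> rw [h] <;> norm_num
    show (D.c : ℂ) * cuspSymbol D.f ⟨γ, hγ0⟩ = (m : ℂ) * 0
    rw [cuspSymbol_eq_zero_of_discr_eq_zero D.f hdisc]; simp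

/-! ## §3 `Γ₁(N) ≤ Γ₁^{(m)}` contradicts optimality -/

/-- **No optimal `X₁(N)`-datum has all its `Γ₁(N)`-periods in `mΛ_W`, `m ≥ 2`.**  If `c·{∞,γ∞}_f ∈ mΛ_W` for every `γ ∈ Γ₁(N)` then
`c·Λ₁(f) ⊆ mΛ_W`; optimality `Λ_W = c·Λ₁(f)` gives `ω₁ ∈ mΛ_W`, i.e. `ω₁/m ∈ Λ_W` — impossible (`PeriodPair.mul_ω₁_add_mul_ω₂_mem_lattice`).
[cite: Stevens1989, §2 (optimality: `Λ(E₁) = c·Λ₁(f)`)] -/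
theorem not_forall_gamma1_division_of_isOptimal (D : Gamma1ParametrizationData W N) (hopt : D.IsOptimal) {m : ℕ} (hm : 2 ≤ m) :
    ¬ ∀ γ : Gamma1 N, ∃ ν ∈ D.L.lattice,
        (D.c : ℂ) * cuspSymbol D.f ⟨(γ : SL(2, ℤ)), Gamma1_in_Gamma0 N γ.2⟩ = (m : ℂ) * ν := by
  intro h
  -- closure induction over the `Γ₁(N)`-symbols generating `Λ₁(f)`
  have key : ∀ z ∈ periodLatticeGamma1 D.f, ∃ ν ∈ D.L.lattice, (D.c : ℂ) * z = (m : ℂ) * ν := by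
    intro z hz
    induction hz using AddSubgroup.closure_induction with
    | mem x hx =>
      obtain ⟨γ, rfl⟩ := hx
      exact h γ
    | zero => exact ⟨0, zero_mem _, by simp⟩
    | add x y _ _ hx hy =>
      obtain ⟨ν₁, hν₁, e₁⟩ := hx
      obtain ⟨ν₂, hν₂, e₂⟩ := hy
      exact ⟨ν₁ + ν₂, add_mem hν₁ hν₂, by rw [mul_add, e₁, e₂]; ring⟩
    | neg x _ hx =>
      obtain ⟨ν, hν, e⟩ := hx
      exact ⟨-ν, neg_mem hν, by rw [mul_neg, e]; ring⟩
  obtain ⟨w, hw, hw'⟩ := hopt D.L.ω₁ D.L.ω₁_mem_lattice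
  obtain ⟨ν, hν, e⟩ := key w hw
  -- `ω₁ = m ν`, so `ν = (1/m) ω₁ + 0 ω₂ ∈ Λ_W`
  have hm0 : (m : ℂ) ≠ 0 := by exact_mod_cast (show m ≠ 0 by omega)
  have hν' : (((m : ℚ)⁻¹ : ℚ) : ℂ) * D.L.ω₁ + ((0 : ℚ) : ℂ) * D.L.ω₂ = ν := by
    have : D.L.ω₁ = (m : ℂ) * ν := by rw [hw', e]
    push_cast
    rw [this, zero_mul, add_zero, ← mul_assoc, inv_mul_cancel₀ hm0, one_mul]
  have hνmem : (((m : ℚ)⁻¹ : ℚ) : ℂ) * D.L.ω₁ + ((0 : ℚ) : ℂ) * D.L.ω₂ ∈ D.L.lattice := by rw [hν']; exact hν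
  have hden := (PeriodPair.mul_ω₁_add_mul_ω₂_mem_lattice (L := D.L) (α := (m : ℚ)⁻¹) (β := 0)).mp hνmem
  rw [Rat.inv_natCast_den, if_neg (by omega)] at hden
  omega

/-! ## §4 The UDC glue on `Γ₁(N)`: a division witness with algebraic-integer `q`-expansion forces `Γ₁(N) ≤ Γ₁^{(m)}` -/

omit [NeZero N] in
/-- `Γ(M) ≤ Γ₁(M)`. [cite: DiamondShurman2005, §1.2] -/
theorem Gamma_le_Gamma1 (M : ℕ) : CongruenceSubgroup.Gamma M ≤ Gamma1 M := by
  intro γ hγ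
  rw [Gamma1_mem]
  obtain ⟨h00, -, h10, h11⟩ := Gamma_mem.mp hγ
  exact ⟨h00, h11, h10⟩

/-- **Division witness ∧ Unbounded Denominators ⟹ `Γ₁(N) ≤ Γ₁^{(m)}`.**  If some holomorphic `F : ℍ → ℂ` of weight `k` has `Γ₁(N)`-stabiliser
EXACTLY the division cover group `Γ₁^{(m)}` (invariant under it; invariance forces membership), exponential growth at every cusp and an
algebraic-integer `q`-expansion, then — modulo `UnboundedDenominatorsWeightAlgInt k` — `Γ₁^{(m)} ⊇ Γ(MN)` is congruence, hence (§1) contains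
`Γ₁(N)`: every `Γ₁(N)`-period has `c·{∞,γ∞}_f ∈ mΛ_W`. [cite: CalegariDimitrovTang2025, Thm. 1.0.1] [cite: Wohlfahrt1964, Thm. 2] -/
theorem forall_gamma1_division_of_divisionWitness_of_UDW (D : Gamma1ParametrizationData W N) {m : ℕ} (hm : 0 < m) {k : ℤ}
    (hUDW : UnboundedDenominatorsWeightAlgInt k) {F : UpperHalfPlane → ℂ} (hhol : MDifferentiable 𝓘(ℂ) 𝓘(ℂ) F)
    (hinv : ∀ γ : Gamma1 N, (∃ ν ∈ D.L.lattice,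
      (D.c : ℂ) * cuspSymbol D.f ⟨(γ : SL(2, ℤ)), Gamma1_in_Gamma0 N γ.2⟩ = (m : ℂ) * ν) → F ∣[k] (γ : SL(2, ℤ)) = F)
    (hstab : ∀ γ : Gamma1 N, F ∣[k] (γ : SL(2, ℤ)) = F → ∃ ν ∈ D.L.lattice,
      (D.c : ℂ) * cuspSymbol D.f ⟨(γ : SL(2, ℤ)), Gamma1_in_Gamma0 N γ.2⟩ = (m : ℂ) * ν)
    (hgrowth : ∀ g : SL(2, ℤ), ∃ C A r : ℝ, ∀ τ : UpperHalfPlane, A ≤ τ.im → ‖(F ∣[k] g) τ‖ ≤ C * Real.exp (r * τ.im))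
    (hq : ∃ b : ℕ → ℂ, (∀ n, IsIntegral ℤ (b n)) ∧ ∀ τ : UpperHalfPlane,
      HasSum (fun n : ℕ ↦ b n * Complex.exp (2 * Real.pi * Complex.I * (τ : ℂ) * n)) (F τ)) :
    ∀ γ : Gamma1 N, ∃ ν ∈ D.L.lattice,
      (D.c : ℂ) * cuspSymbol D.f ⟨(γ : SL(2, ℤ)), Gamma1_in_Gamma0 N γ.2⟩ = (m : ℂ) * ν := by
  obtain ⟨Γ, hmem, hle, hfi, htr⟩ := exists_divisionCoverSubgroupGamma1 D hm
  have hN : 0 < N := Nat.pos_of_ne_zero (NeZero.ne N)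
  have hΓinv : ∀ γ ∈ Γ, F ∣[k] γ = F := by
    intro γ hγ
    have hγ1 : γ ∈ Gamma1 N := hle hγ
    exact hinv ⟨γ, hγ1⟩ ((hmem ⟨γ, hγ1⟩).mp hγ)
  obtain ⟨M, hM, hcong⟩ := hUDW Γ hfi F hhol hΓinv hgrowth hq
  -- `Γ(MN) ≤ Γ₁^{(m)}`
  have hΓMN : CongruenceSubgroup.Gamma (M * N) ≤ Γ := by
    intro g hg
    have hgN : g ∈ CongruenceSubgroup.Gamma N := Gamma_mul_le_right M N hg
    have hgM : g ∈ CongruenceSubgroup.Gamma M := Gamma_mul_le_left M N hg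
    have hg1 : g ∈ Gamma1 N := Gamma_le_Gamma1 N hgN
    exact (hmem ⟨g, hg1⟩).mpr (hstab ⟨g, hg1⟩ (hcong g hgM))
  -- §1: `Γ₁(N) ≤ Γ₁^{(m)}`
  have h1 : Gamma1 N ≤ Γ :=
    gamma1_le_of_Gamma_le_of_forall_trace_two_mem N Γ (fun γ hγ h2 ↦ htr γ hγ (Or.inl h2)) (Nat.mul_pos hM hN) hΓMN
  intro γ
  exact (hmem γ).mp (h1 γ.2)

/-- **`m ∤ c₁` ⟸ CDT ∧ (`m`-division witness law on `Γ₁`), for every OPTIMAL `X₁(N)`-datum, every `m ≥ 2`, every level.**  `hW` is the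
`m`-DIVISION WITNESS LAW ON `Γ₁` (OPEN analytic stub; on paper `F = t((c/m)·E_f)·B_d·Δ^k`, Honda at `c/m`): for every optimal `X₁(N)`-datum of a
globally minimal curve with `m ∣ c` a holomorphic weight-`k` witness with `Γ₁(N)`-stabiliser `Γ₁^{(m)}`, exponential growth at the cusps and
algebraic-integer `q`-expansion.  CONDITIONAL; Stevens' conjecture is not proved by this. [cite: CalegariDimitrovTang2025, Thm. 1.0.1 and Remarks 58–59]
[cite: Stevens1989, §2] -/
theorem not_dvd_maninConstant₁_of_CDT_of_divisionWitnessLaw₁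
    (hCDT : Literature.NumberTheory.Automorphic.CalegariDimitrovTang2025_unboundedDenominators_algInt) {m : ℕ} (hm : 2 ≤ m)
    (hW : ∀ (W : WeierstrassCurve ℚ) [W.IsElliptic] [W.IsGloballyMinimal] {N : ℕ} [NeZero N] (D : Gamma1ParametrizationData W N),
      D.IsOptimal → (m : ℤ) ∣ D.c →
      ∃ (k : ℤ) (F : UpperHalfPlane → ℂ), MDifferentiable 𝓘(ℂ) 𝓘(ℂ) F ∧
        (∀ γ : Gamma1 N, (∃ ν ∈ D.L.lattice,
          (D.c : ℂ) * cuspSymbol D.f ⟨(γ : SL(2, ℤ)), Gamma1_in_Gamma0 N γ.2⟩ = (m : ℂ) * ν) → F ∣[k] (γ : SL(2, ℤ)) = F) ∧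
        (∀ γ : Gamma1 N, F ∣[k] (γ : SL(2, ℤ)) = F → ∃ ν ∈ D.L.lattice,
          (D.c : ℂ) * cuspSymbol D.f ⟨(γ : SL(2, ℤ)), Gamma1_in_Gamma0 N γ.2⟩ = (m : ℂ) * ν) ∧
        (∀ g : SL(2, ℤ), ∃ C A r : ℝ, ∀ τ : UpperHalfPlane, A ≤ τ.im → ‖(F ∣[k] g) τ‖ ≤ C * Real.exp (r * τ.im)) ∧
        (∃ b : ℕ → ℂ, (∀ n, IsIntegral ℤ (b n)) ∧ ∀ τ : UpperHalfPlane,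
          HasSum (fun n : ℕ ↦ b n * Complex.exp (2 * Real.pi * Complex.I * (τ : ℂ) * n)) (F τ)))
    [W.IsElliptic] [W.IsGloballyMinimal] (D : Gamma1ParametrizationData W N) (hopt : D.IsOptimal) :
    ¬ (m : ℤ) ∣ D.maninConstant := by
  intro hmc
  obtain ⟨k, F, hhol, hinv, hstab, hgrowth, hq⟩ := hW W D hopt hmc
  exact not_forall_gamma1_division_of_isOptimal D hopt hm
    (forall_gamma1_division_of_divisionWitness_of_UDW D (by omega)
      (UDWOfCDT.unboundedDenominatorsWeightAlgInt_of_CDT_algInt hCDT k) hhol hinv hstab hgrowth hq)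

/-! ## §5 `|c₁| = 1` modulo CDT and the prime-division witness laws on `Γ₁` (Stevens' `c_φ = ±1`, conditional) -/

/-- **`|c₁| = 1` ⟸ CDT ∧ (the `p`-division witness laws on `Γ₁`, `p` prime).**  For every OPTIMAL `X₁(N)`-datum of a globally minimal curve, at
every level: no prime divides `c₁` (§4 at `m = p`), and `c₁ ≠ 0` (`maninConstant_ne_zero`), so `|c₁| = 1` — Stevens' conjecture `c_φ = ±1`
[Stevens 1989] modulo the printed CDT fact and the analytic witness laws.  CONDITIONAL; Stevens' conjecture, Manin's conjecture and BSD are not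
proved by this. [cite: Stevens1989, §2 (Conjecture: `c = ±1` for the `X₁(N)`-optimal parametrisation)] [cite: CalegariDimitrovTang2025, Thm. 1.0.1] -/
theorem abs_maninConstant₁_eq_one_of_CDT_of_divisionWitnessLaws₁
    (hCDT : Literature.NumberTheory.Automorphic.CalegariDimitrovTang2025_unboundedDenominators_algInt)
    (hW : ∀ p : ℕ, p.Prime → ∀ (W : WeierstrassCurve ℚ) [W.IsElliptic] [W.IsGloballyMinimal] {N : ℕ} [NeZero N]
      (D : Gamma1ParametrizationData W N), D.IsOptimal → (p : ℤ) ∣ D.c →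
      ∃ (k : ℤ) (F : UpperHalfPlane → ℂ), MDifferentiable 𝓘(ℂ) 𝓘(ℂ) F ∧
        (∀ γ : Gamma1 N, (∃ ν ∈ D.L.lattice,
          (D.c : ℂ) * cuspSymbol D.f ⟨(γ : SL(2, ℤ)), Gamma1_in_Gamma0 N γ.2⟩ = (p : ℂ) * ν) → F ∣[k] (γ : SL(2, ℤ)) = F) ∧
        (∀ γ : Gamma1 N, F ∣[k] (γ : SL(2, ℤ)) = F → ∃ ν ∈ D.L.lattice,
          (D.c : ℂ) * cuspSymbol D.f ⟨(γ : SL(2, ℤ)), Gamma1_in_Gamma0 N γ.2⟩ = (p : ℂ) * ν) ∧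
        (∀ g : SL(2, ℤ), ∃ C A r : ℝ, ∀ τ : UpperHalfPlane, A ≤ τ.im → ‖(F ∣[k] g) τ‖ ≤ C * Real.exp (r * τ.im)) ∧
        (∃ b : ℕ → ℂ, (∀ n, IsIntegral ℤ (b n)) ∧ ∀ τ : UpperHalfPlane,
          HasSum (fun n : ℕ ↦ b n * Complex.exp (2 * Real.pi * Complex.I * (τ : ℂ) * n)) (F τ)))
    [W.IsElliptic] [W.IsGloballyMinimal] (D : Gamma1ParametrizationData W N) (hopt : D.IsOptimal) :
    |D.maninConstant| = 1 := by
  have hc0 : D.maninConstant ≠ 0 := D.maninConstant_ne_zero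
  rw [Int.abs_eq_natAbs]
  by_contra hne
  have hne' : D.maninConstant.natAbs ≠ 1 := fun h ↦ hne (by rw [h]; rfl)
  obtain ⟨p, hp, hpd⟩ := Nat.exists_prime_and_dvd hne'
  have hpc : (p : ℤ) ∣ D.maninConstant := Int.natCast_dvd.mpr hpd
  exact not_dvd_maninConstant₁_of_CDT_of_divisionWitnessLaw₁ hCDT hp.two_le (hW p hp) D hopt hpc

end Summit.BirchSwinnertonDyer.BirchSwinnertonDyer.Theorems.ManinLocalTwoThree.DivisionGamma1

end
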